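import Literature.MathematicalPhysics.QuantumFieldTheory.Balaban1983to89.B6Ineq2134DiagIn
import Literature.MathematicalPhysics.QuantumFieldTheory.Balaban1983to89.B6Prop27Kernel

/-!
# `Balaban1983to89.B6Ineq2134TransposeDiag` — T. Bałaban, *Propagators and renormalization transformations for lattice gauge theories. II*,
# Commun. Math. Phys. **96** (1984) 223–250 [Balaban1984PropagatorsII], (2.134) p. 247 FOR THE REVERSED KERNELS `h_{□′}G_{□′}K̃_{□,□′}` of the transposed
# walk `G = G₀ + R̃G` (the route to the right-factor entry `|(G∇*J)(x)|` of Prop. 2.6 (2.136)), generic over the block geometry: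
# line 1 of (2.92) read from the right as input-weighted sandwiches, lines 2 and 4 by r03's commutator lemma, line 3 and the off-diagonal
# (2.93) as two-step chains with the scale ratio read in the opposite orientation

statement-level skeleton of published theorems with citation tags; proofs where landed; nothing here is a claim about the Yang–Mills mass gap

PDF held: `paper:balaban1984-cmp96-propagators-rt-ii` (journal page = PDF page + 222); p. 247 [PDF 25] ((2.133)–(2.136)), p. 239 [PDF 17] ((2.91)–(2.93)), p. 234
[PDF 12] (Lemma 2.1 (2.60)–(2.63), Prop. 2.2 *"The similar inequalities hold …"*) re-read this generation on the ×2 renders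
`b2b-balaban-ref1/pages/1984-cmp96-propagators-rt-II/…-p012/p017/p025-x2.png`; the operator shapes are read from the tree transcriptions
`…B6Ineq2134Diag` (r03), `…B6Ineq2134DiagIn` (p38 gen 27), `…B6Ineq2134OffDiag` (r03).

CITATION HEADER (lean-in-tree rule) — WHAT IS REPRODUCED.  Phase-2 file of the `lit-balaban` typed skeleton (HOME `run/shared/lean/pub/lit-balaban/`), seat
**p38 gen 31**, brick 3 of the programme «(2.136)₃ by the transposed walk» (HOME/STATUS.md 2026-08-23T16:53:34Z; bricks 1–2 = `…B6Prop26RightChainGeneric`,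
`…B6Eq291Transpose`; p22 g23 supplies the cube-level right legs `B6CubeRightLegsV1` and the transposed line 3 `B6Line3CubeTransposeV1`); SKELETON rows
**B6.Eq2.134** × B6.Eq2.92 × B6.Eq2.93 × B6.Prop2.6 (cells only; decls of record untouched).
Print bounds every term `K_{□,□′}G_{□′}h_{□′}` of `R` by `O(M⁻¹)e^{−δ₂d}` ((2.134)) and says the four entries of (2.136) follow *"reasoning in the same way as in
the proof of Proposition 2.2"*.  For the right-factor entry the walk must be run from the right (`…B6Eq291Transpose`: `G₀Δ_a = 1 − R̃`,
`R̃ = Σ h_{□′}G_{□′}K̃_{□,□′}`, `K̃` = (2.92)–(2.93) with every product reversed), so (2.134) is needed for the REVERSED terms `h_{□′}G_{□′}K̃_{□,□′}`: the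
propagator now stands on the LEFT of the kernel.  THIS FILE proves those bounds over an arbitrary block geometry `g` (`blk : X → 𝔅`, the tree's
`HasMajorant`/`LocalMajorant`/`InMajorant`, Lemma 2.1 only through `…B6Lemma21Repaired.Ineq263With` and the level separation `…B6Ineq268.LevelSep` with the
threshold `L² ≤ e^{⅛δ₂RM}` exactly as r03's direct files), from hypotheses of the shapes the cube files deliver:
* §1 carriers: `hasMajorant_mulOp_right`, `hasMajorant_left_of_out` (an OUTPUT-localised majorant and a left factor `h` supported there give a global
  majorant of `h·T` — the mirror of p38's `hasMajorant_of_inMajorant`), **`hasMajorant_sandwichLocW`** (`a·T·c` with `|a| ≤ 1` and the WEIGHT `|c(x′)| ≤ α(y′)`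
  on the RIGHT factor — the mirror of r03's `hasMajorant_sandwichW`), indicator decorations `hasMajorant_indOut`, `hasMajorant_indIn_of_inLoc`;
* §2 the scalar step read in the opposite orientation: **`ratio_exp_le`** (`(L^{j}η)²/(L^{j″}η)²·e^{−δ₂d(y,y″)} ≤ L²·e^{−⅞δ₂d(y,y″)}` from (2.60) = `LevelSep`
  and `L² ≤ e^{⅛δ₂RM}`, via p38's `…B6Prop27Kernel.ratioP_mul_exp_le`), `lip_exp_le`;
* §3 **`line1T_hasMajorant`** — line 1 of (2.92) from the right: `h_□G_□(Σ_i E_i·c_i − c₀)` with the first-order pieces `G_□∘E_i` and `G_□` under LOCAL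
  majorants `C·(L^jη)²e^{−δ₂d}` over the reach and the coefficients `|c_i(x′)| ≤ s₁/(M(L^{j′}η)²)`, `|c₀| ≤ s₂/(M(L^{j′}η)²)` read at the INPUT bond:
  majorant `((#D·s₁C₁ + s₂C_G)L²/M)·e^{−⅞δ₂d}`;
* §4 **`commLineT_hasMajorant`** (+ `_midCut`, `_rightCut`) — lines 2 and 4 from the right: `(h_□G_□)·(h_□N − Nh_□)` with the GLOBAL majorant
  `C_G(L^jη)²e^{−δ₂d}` of `h_□G_□` (outputs in `supp h_□`, inputs anywhere: the cube's OUT-leg) and r03/p38's `hasMajorant_comm_inout` BY NAME for the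
  commutator: majorant `(s/M)·C_NC_GL²(8/δ₂ + r₀)c²·e^{−½δ₂d}`;
* §5 **`domLineT_hasMajorant`** — line 3 from the right: `(h_□G_□)·D₃ᵀ` with `D₃ᵀ = h_□(∂P∂* − ∂P_□∂*)ζ_□` under the majorant `C_De^{−c_DM}(L^{j″}η)^{−2}e^{−δ₂d}`
  (p22's `line3_cube_transpose`): majorant `C_De^{−c_DM}C_GL²c²·e^{−½δ₂d}`;
* §6 **`offDiagT_hasMajorant`** — (2.93) from the right: `(h_{□′}G_{□′})·(h_{□′}∂P∂*(1 − ζ_{□′}))·h_□²` with the gap `mM` between `supp h_{□′}` and `{ζ_{□′} ≠ 1}`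
  read from the output side: majorant `C_PC_GL²c²e^{−⅛δ₂mM}·e^{−½δ₂d}`, and `thetaT_le` (`= O(M⁻¹)`);
* §7 **`diagT_hasMajorant`** — the whole reversed diagonal kernel `h_□G_□K̃_{□,□}` in the decomposed form
  `h_□G_□·((((Σ_iE_ic_i − c₀) + Σ_k(h_□N_k − N_kh_□)z_k) + D₃ᵀ) + (h_□P_□ − P_□h_□)ζ_□)` (the transpose of p38 gen 29's `hdec`): majorant `θ_diagᵀ·e^{−½δ₂d}`,
  and `compactT_inLoc` (the input localisation of the compact form over `□̃`),
  `θ_diagᵀ = (#D·s₁C₁ + s₂C_G)L²/M + (#K + 1)(s/M)C_NC_GL²(8/δ₂ + r₀)c² + C_De^{−c_DM}C_GL²c²` (the direct `θ_diag` with one more `L²` on line 1).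
THEOREMS ONLY (no `def`, no `def … : Prop`, no new hypothesis-shaped fact); standard axioms.

HONEST SCOPE / DIVERGENCES.  (1) As r03's direct files: abstract carrier, `∂P∂*`/`N_k`/`P_□`/`D₃ᵀ` enter through majorant HYPOTHESES of the printed
shapes ((2.88), (2.133), p22's transposed line 3), discharged for the genuine V1 operators downstream; Lemma 2.1 as repaired (`Ineq263With c`).  (2) The
propagator hypotheses are stated with print's prefactor `(L^jη)²` at the OUTPUT block (the shape of r03's `hGin_cube` and p22's `hGout_cube`/`hGEin_cube`);
reading a coefficient or a partner at the other end of `G_□` costs the scale ratio `L^{2(j−j″)}`, absorbed by `e^{−⅛δ₂d}` through (2.60) exactly as in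
print's *"remarks after (2.68)"* — hence the extra `L²` and the rates `⅞δ₂`, `½δ₂`.  (3) The decomposition of `[M_□, h_□]` with INPUT-side coefficients
(`Σ_iE_ic_i − c₀`) is the consumer's identity (the V1 cube file obtains it from p38 gen 29's `hdec` by transposition).  (4) Print does not spell the right-factor walk out; see
`…B6Prop26RightChainGeneric`'s header and HOME/GAPS.md.  Nothing on d = 4 or the continuum; NOT summit progress.  Unit `lit-balaban-p38` (gen 31), 2026-08-23.
-/

namespace Literature.MathematicalPhysics.QuantumFieldTheory.Balaban1983to89.B6Ineq2134TransposeDiag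

open B6RandomWalk B6Prop26Gluing Finset
open B6Ineq268 (LevelSep mx mx_nonneg)
open B6Lemma21Repaired (Ineq263With)
open B6Ineq2134OffDiag (sum_le)
open B6Ineq2134DiagIn (hasMajorant_comm_inout)
open B6InMajorantTransplant (InMajorant)
open B6Prop27Kernel (ratioP ratioP_nonneg ratioP_eq_len ratioP_mul_exp_le)

variable {g : B6.Geometry} {X : Type}

/-! ## §1  Carriers -/

section Carrier

/-- a right cut-off `|z| ≤ 1` does not increase a majorant (`supp λ`, `|λ|` unchanged). [cite: Balaban1984PropagatorsII, (2.92) p.239 (ζ_□), (2.51) p.232] -/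
theorem hasMajorant_mulOp_right (blk : X → g.Site) {T : Module.End ℝ (X → ℝ)} {K : g.Site → g.Site → ℝ}
    (hT : HasMajorant blk T K) {z : X → ℝ} (hz : ∀ x, |z x| ≤ 1) : HasMajorant blk (T * mulOp z) K := by
  intro y' μ B hμ x
  rw [Module.End.mul_apply]
  exact hT y' (mulOp z μ) B (blockSupp_mulOp blk hz hμ) x

/-- majorants pass to `−T`. [cite: Balaban1984PropagatorsII, (2.51) p.232, bookkeeping] -/
private theorem hasMajorant_neg' (blk : X → g.Site) {T : Module.End ℝ (X → ℝ)} {K : g.Site → g.Site → ℝ}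
    (hT : HasMajorant blk T K) : HasMajorant blk (-T) K := by
  intro y' μ B hμ x
  rw [LinearMap.neg_apply, Pi.neg_apply, abs_neg]
  exact hT y' μ B hμ x

/-- **`h_□G_□` AS A GLOBAL OPERATOR FROM AN OUTPUT-LOCALISED BOUND** (the mirror of p38's `hasMajorant_of_inMajorant`): a majorant `K ≥ 0` of `T` for OUTPUTS
over `S` (inputs anywhere) and a left factor `|h| ≤ 1` supported over `S` give the global majorant `K` of `h·T`.
[cite: Balaban1984PropagatorsII, (2.133) p.247, (2.91) p.239] -/
theorem hasMajorant_left_of_out (blk : X → g.Site) {T : Module.End ℝ (X → ℝ)} {h : X → ℝ} {S : Set g.Site}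
    {K : g.Site → g.Site → ℝ} (hK : ∀ y y', 0 ≤ K y y')
    (hout : ∀ (y' : g.Site) (μ : X → ℝ) (B : ℝ), BlockSupp blk μ y' B → ∀ x, blk x ∈ S → |T μ x| ≤ K (blk x) y' * B)
    (hsupp : ∀ x, h x ≠ 0 → blk x ∈ S) (hle : ∀ x, |h x| ≤ 1) :
    HasMajorant blk (mulOp h * T) K := by
  intro y' μ B hμ x
  rw [Module.End.mul_apply, mulOp_apply]
  by_cases hx : h x = 0
  · rw [hx, zero_mul, abs_zero]
    exact mul_nonneg (hK _ _) hμ.nonneg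
  · rw [abs_mul]
    calc |h x| * |T μ x| ≤ 1 * (K (blk x) y' * B) := mul_le_mul (hle x) (hout y' μ B hμ x (hsupp x hx)) (abs_nonneg _) zero_le_one
      _ = K (blk x) y' * B := one_mul _

/-- **THE INPUT-WEIGHTED SANDWICH `a·T·c`** (every term of line 1 of (2.92) read from the right: `a = h_□`, `T = G_□∘E_i` or `G_□`, `c = c_i` or `c₀`): a LOCAL
majorant `K ≥ 0` of `T` over the reach `S`, a left factor `|a| ≤ 1` supported over `S` and a right factor with `|c(x′)| ≤ α(y′)` (`x′ ∈ B(y′)`) supported over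
`S` give the GLOBAL majorant `1_S(y)1_S(y′)·K(y,y′)·α(y′)` (the mirror of r03's `hasMajorant_sandwichW`, weight at the INPUT block).
[cite: Balaban1984PropagatorsII, (2.92) p.239 + (2.133) p.247] -/
theorem hasMajorant_sandwichLocW (blk : X → g.Site) {T : Module.End ℝ (X → ℝ)} {a c : X → ℝ} {S : Set g.Site}
    {K : g.Site → g.Site → ℝ} {α : g.Site → ℝ} (hK : ∀ y y', 0 ≤ K y y') (hα : ∀ y, 0 ≤ α y)
    (haS : ∀ x, a x ≠ 0 → blk x ∈ S) (ha1 : ∀ x, |a x| ≤ 1) (hcS : ∀ x, c x ≠ 0 → blk x ∈ S) (hc : ∀ x, |c x| ≤ α (blk x))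
    (hT : LocalMajorant blk T S K) :
    HasMajorant blk (mulOp a * T * mulOp c) (fun y y' => ind S y * ind S y' * (K y y' * α y')) := by
  intro y' μ B hμ x
  beta_reduce
  have hnn : 0 ≤ ind S (blk x) * ind S y' * (K (blk x) y' * α y') * B :=
    mul_nonneg (mul_nonneg (mul_nonneg (ind_nonneg _ _) (ind_nonneg _ _)) (mul_nonneg (hK _ _) (hα _))) hμ.nonneg
  rw [Module.End.mul_apply, Module.End.mul_apply, mulOp_apply]
  by_cases hx : a x = 0
  · rw [hx, zero_mul, abs_zero]
    exact hnn
  have hxS : blk x ∈ S := haS x hx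
  by_cases hy : y' ∈ S
  · -- the weighted input `cμ` is supported in the block of `y′` with bound `α(y′)·B`
    have hcμ : BlockSupp blk (mulOp c μ) y' (α y' * B) := by
      refine ⟨mul_nonneg (hα _) hμ.nonneg, fun x' hx' => ?_, fun x' hx' => ?_⟩
      · rw [mulOp_apply, abs_mul, ← hx']
        exact mul_le_mul (hc x') (hμ.bound x' hx') (abs_nonneg _) (hα _)
      · rw [mulOp_apply, hμ.off x' hx', mul_zero]
    rw [ind_of_mem hxS, ind_of_mem hy, one_mul, one_mul, abs_mul]
    calc |a x| * |T (mulOp c μ) x| ≤ 1 * (K (blk x) y' * (α y' * B)) :=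
          mul_le_mul (ha1 x) (hT y' hy (mulOp c μ) (α y' * B) hcμ x hxS) (abs_nonneg _) zero_le_one
      _ = K (blk x) y' * α y' * B := by ring
  · rw [mulOp_eq_zero_of_blockSupp blk hcS hμ hy, map_zero, Pi.zero_apply, mul_zero, abs_zero]
    exact hnn

/-- OUTPUT INDICATOR FOR FREE: `h·T` with `h` supported over `U` has the majorant `1_U(y)·K` once it has `K ≥ 0`.
[cite: Balaban1984PropagatorsII, (2.91)–(2.92) p.239 (supp h_□ ⊂ □̃), bookkeeping] -/
theorem hasMajorant_indOut (blk : X → g.Site) {T : Module.End ℝ (X → ℝ)} {h : X → ℝ} {U : Set g.Site} {K : g.Site → g.Site → ℝ}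
    (hK : ∀ y y', 0 ≤ K y y') (hT : HasMajorant blk (mulOp h * T) K) (hsupp : ∀ x, h x ≠ 0 → blk x ∈ U) :
    HasMajorant blk (mulOp h * T) (fun y y' => ind U y * K y y') := by
  intro y' μ B hμ x
  beta_reduce
  by_cases hxU : blk x ∈ U
  · rw [ind_of_mem hxU, one_mul]
    exact hT y' μ B hμ x
  · have h0 : h x = 0 := by
      by_contra hne
      exact hxU (hsupp x hne)
    rw [Module.End.mul_apply, mulOp_apply, h0, zero_mul, abs_zero]
    exact mul_nonneg (mul_nonneg (ind_nonneg _ _) (hK _ _)) hμ.nonneg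

/-- INPUT INDICATOR FOR FREE: an input-localised operator (`InLoc T U`) with a majorant `K ≥ 0` has the majorant `1_U(y′)·K`.
[cite: Balaban1984PropagatorsII, (2.91)–(2.93) p.239 (supp ζ_□, supp h_□ ⊂ □̃), bookkeeping] -/
theorem hasMajorant_indIn_of_inLoc (blk : X → g.Site) {T : Module.End ℝ (X → ℝ)} {U : Set g.Site} {K : g.Site → g.Site → ℝ}
    (hK : ∀ y y', 0 ≤ K y y') (hT : HasMajorant blk T K) (hin : InLoc blk T U) :
    HasMajorant blk T (fun y y' => ind U y' * K y y') := by
  intro y' μ B hμ x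
  beta_reduce
  by_cases hyU : y' ∈ U
  · rw [ind_of_mem hyU, one_mul]
    exact hT y' μ B hμ x
  · rw [hin y' μ B hμ hyU, Pi.zero_apply, abs_zero]
    exact mul_nonneg (mul_nonneg (ind_nonneg _ _) (hK _ _)) hμ.nonneg

/-- both indicators at once. [cite: Balaban1984PropagatorsII, (2.91)–(2.93) p.239, bookkeeping] -/
theorem hasMajorant_indOutIn (blk : X → g.Site) {T : Module.End ℝ (X → ℝ)} {h : X → ℝ} {U : Set g.Site} {K : g.Site → g.Site → ℝ}
    (hK : ∀ y y', 0 ≤ K y y') (hT : HasMajorant blk (mulOp h * T) K) (hsupp : ∀ x, h x ≠ 0 → blk x ∈ U) (hin : InLoc blk (mulOp h * T) U) :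
    HasMajorant blk (mulOp h * T) (fun y y' => ind U y * ind U y' * K y y') := by
  have h1 := hasMajorant_indIn_of_inLoc blk hK hT hin
  have h2 := hasMajorant_indOut blk (fun y y' => mul_nonneg (ind_nonneg _ _) (hK y y')) h1 hsupp
  refine hasMajorant_mono blk h2 fun y y' => ?_
  exact (by ring : ind U y * (ind U y' * K y y') = ind U y * ind U y' * K y y').le

end Carrier

/-! ## §2  The scalar step in the opposite orientation -/

section Scalar

/-- **THE SCALE RATIO READ FROM THE RIGHT**: `(L^jη)²/(L^{j″}η)²·e^{−δ₂d(y,y″)} ≤ L²·e^{−⅞δ₂d(y,y″)}` — one factor `e^{−⅛δ₂d(y,y″)}` absorbs `L^{2(j−j″)}`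
through (2.60) (`LevelSep`: `RM·max{|j−j″|−1,0} ≤ d(y,y″)`) and `L² ≤ e^{⅛δ₂RM}` (*"the remarks after (2.68)"*).
[cite: Balaban1984PropagatorsII, Lemma 2.1 (2.60) p.234, (2.68) p.235, (2.134) p.247] -/
theorem ratio_exp_le (hL : 1 ≤ g.L) (hη : 0 < g.eta) (hsep : LevelSep g) {δ₂ : ℝ} (hδ₂ : 0 ≤ δ₂)
    (hRM : 0 ≤ g.R * g.M) (hthr : g.L ^ 2 ≤ Real.exp (1 / 8 * δ₂ * (g.R * g.M))) (y y'' : g.Site) :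
    g.len y ^ 2 / g.len y'' ^ 2 * Real.exp (-(δ₂ * g.dist y y'')) ≤ g.L ^ 2 * Real.exp (-(7 / 8 * δ₂ * g.dist y y'')) := by
  have hβ : 0 ≤ 1 / 8 * δ₂ * (g.R * g.M) := by positivity
  have h1 := ratioP_mul_exp_le (g := g) hL hβ 2 hthr y y''
  rw [← ratioP_eq_len hη.ne' 2 y y'']
  have hmx : g.R * g.M * mx g y y'' ≤ g.dist y y'' := hsep y y''
  have h2 : Real.exp (-(1 / 8 * δ₂ * g.dist y y'')) ≤ Real.exp (-(1 / 8 * δ₂ * (g.R * g.M) * mx g y y'')) := by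
    apply Real.exp_le_exp.mpr
    have : 1 / 8 * δ₂ * (g.R * g.M * mx g y y'') ≤ 1 / 8 * δ₂ * g.dist y y'' := mul_le_mul_of_nonneg_left hmx (by positivity)
    nlinarith
  have hsplit : Real.exp (-(δ₂ * g.dist y y'')) = Real.exp (-(1 / 8 * δ₂ * g.dist y y'')) * Real.exp (-(7 / 8 * δ₂ * g.dist y y'')) := by
    rw [← Real.exp_add]; congr 1; ring
  rw [hsplit, ← mul_assoc]
  refine mul_le_mul_of_nonneg_right ?_ (Real.exp_nonneg _)
  exact (mul_le_mul_of_nonneg_left h2 (ratioP_nonneg (zero_le_one.trans hL) 2 y y'')).trans h1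

/-- `t·e^{−at} ≤ a⁻¹` (`a > 0`). [cite: Balaban1984PropagatorsII, (2.134) p.247, bookkeeping] -/
private theorem mul_exp_le {a : ℝ} (ha : 0 < a) (t : ℝ) : t * Real.exp (-(a * t)) ≤ a⁻¹ := by
  have h := Real.add_one_le_exp (a * t)
  rw [Real.exp_neg]
  have hpos : 0 < Real.exp (a * t) := Real.exp_pos _
  rw [mul_inv_le_iff₀ hpos, inv_mul_eq_div, le_div_iff₀ ha]
  nlinarith

/-- **THE LIPSCHITZ FACTOR ABSORBED**: `(t + r₀)·e^{−⅛δ₂t} ≤ 8/δ₂ + r₀` (`t, r₀ ≥ 0`, `δ₂ > 0`). [cite: Balaban1984PropagatorsII, (2.134) p.247, bookkeeping] -/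
theorem lip_exp_le {δ₂ t r₀ : ℝ} (hδ₂ : 0 < δ₂) (ht : 0 ≤ t) (hr₀ : 0 ≤ r₀) :
    (t + r₀) * Real.exp (-(1 / 8 * δ₂ * t)) ≤ 8 / δ₂ + r₀ := by
  have h1 := mul_exp_le (a := 1 / 8 * δ₂) (by positivity) t
  have h2 : Real.exp (-(1 / 8 * δ₂ * t)) ≤ 1 := by
    rw [Real.exp_le_one_iff]; nlinarith
  have e8 : (1 / 8 * δ₂)⁻¹ = 8 / δ₂ := by rw [one_div, mul_inv, inv_inv]; field_simp
  rw [e8] at h1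
  calc (t + r₀) * Real.exp (-(1 / 8 * δ₂ * t)) = t * Real.exp (-(1 / 8 * δ₂ * t)) + r₀ * Real.exp (-(1 / 8 * δ₂ * t)) := by ring
    _ ≤ 8 / δ₂ + r₀ * 1 := add_le_add h1 (mul_le_mul_of_nonneg_left h2 hr₀)
    _ = 8 / δ₂ + r₀ := by ring

end Scalar

/-! ## §3  Line 1 of (2.92) read from the right -/

section LineOne

/-- one input-weighted sandwich term: `h_□·T·c` with `T` LOCAL `C_K(L^jη)²e^{−δ₂d}` over `S` and `|c(x′)| ≤ s/(M(L^{j′}η)²)` has the majorant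
`(s·C_K·L²/M)·e^{−⅞δ₂d}` (the scale ratio between the two ends of `G_□` absorbed by `ratio_exp_le`). [cite: Balaban1984PropagatorsII, (2.134) p.247 + (2.92) p.239] -/
theorem sandwichT_term_hasMajorant (blk : X → g.Site) (hL : 1 ≤ g.L) (hη : 0 < g.eta) (hsep : LevelSep g) (hM : 0 < g.M)
    {δ₂ CK s : ℝ} (hδ₂ : 0 ≤ δ₂) (hCK : 0 ≤ CK) (hs : 0 ≤ s) (hRM : 0 ≤ g.R * g.M) (hthr : g.L ^ 2 ≤ Real.exp (1 / 8 * δ₂ * (g.R * g.M)))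
    {T : Module.End ℝ (X → ℝ)} {hI c : X → ℝ} {S : Set g.Site}
    (hT : LocalMajorant blk T S fun y y' => CK * g.len y ^ 2 * Real.exp (-(δ₂ * g.dist y y')))
    (hI1 : ∀ x, |hI x| ≤ 1) (hIS : ∀ x, hI x ≠ 0 → blk x ∈ S)
    (hc : ∀ x, |c x| ≤ s / (g.M * g.len (blk x) ^ 2)) (hcS : ∀ x, c x ≠ 0 → blk x ∈ S) :
    HasMajorant blk (mulOp hI * T * mulOp c) fun y y' => ind S y * ind S y' * (s * CK * g.L ^ 2 / g.M * Real.exp (-(7 / 8 * δ₂ * g.dist y y'))) := by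
  have hL0 : 0 < g.L := zero_lt_one.trans_le hL
  have hlen : ∀ z : g.Site, 0 < g.len z := fun z => mul_pos (pow_pos hL0 _) hη
  have hK : ∀ y y' : g.Site, 0 ≤ CK * g.len y ^ 2 * Real.exp (-(δ₂ * g.dist y y')) := fun y y' => by positivity
  have hα : ∀ y : g.Site, 0 ≤ s / (g.M * g.len y ^ 2) := fun y => by have := hlen y; positivity
  refine hasMajorant_mono blk (hasMajorant_sandwichLocW blk hK hα hIS hI1 hcS hc hT) fun y y' => ?_
  refine mul_le_mul_of_nonneg_left ?_ (mul_nonneg (ind_nonneg _ _) (ind_nonneg _ _))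
  have hr := ratio_exp_le hL hη hsep hδ₂ hRM hthr y y'
  have hl := hlen y'
  have hM0 := hM
  calc CK * g.len y ^ 2 * Real.exp (-(δ₂ * g.dist y y')) * (s / (g.M * g.len y' ^ 2))
      = s * CK / g.M * (g.len y ^ 2 / g.len y' ^ 2 * Real.exp (-(δ₂ * g.dist y y'))) := by
        field_simp
    _ ≤ s * CK / g.M * (g.L ^ 2 * Real.exp (-(7 / 8 * δ₂ * g.dist y y'))) := mul_le_mul_of_nonneg_left hr (by positivity)
    _ = _ := by ring

/-- **LINE 1 OF (2.92) READ FROM THE RIGHT IN (2.134)** — `h_□G_□·(Σ_i E_i·c_i − c₀)`: with `G_□∘E_i` and `G_□` under the LOCAL majorants `C₁(L^jη)²e^{−δ₂d}`,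
`C_G(L^jη)²e^{−δ₂d}` over the reach `S` (the cube's legs `G_□∘∇`, `G_□`), coefficients `|c_i(x′)| ≤ s₁/(M(L^{j′}η)²)`, `|c₀(x′)| ≤ s₂/(M(L^{j′}η)²)` supported over
`S` (read at the INPUT bond) and `|h_□| ≤ 1` supported over `S`: majorant `1_S(y)1_S(y′)·((#D·s₁C₁ + s₂C_G)L²/M)·e^{−⅞δ₂d}`.
[cite: Balaban1984PropagatorsII, (2.134) p.247 + (2.92) p.239 (line 1) + (2.133) p.247] -/
theorem line1T_hasMajorant (blk : X → g.Site) (hL : 1 ≤ g.L) (hη : 0 < g.eta) (hsep : LevelSep g) (hM : 0 < g.M)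
    {δ₂ CG C₁ s₁ s₂ : ℝ} (hδ₂ : 0 ≤ δ₂) (hCG : 0 ≤ CG) (hC₁ : 0 ≤ C₁) (hs₁ : 0 ≤ s₁) (hs₂ : 0 ≤ s₂)
    (hRM : 0 ≤ g.R * g.M) (hthr : g.L ^ 2 ≤ Real.exp (1 / 8 * δ₂ * (g.R * g.M)))
    {ι : Type} (D : Finset ι) {E : ι → Module.End ℝ (X → ℝ)} {c : ι → X → ℝ} {c₀ hI : X → ℝ}
    {Gl : Module.End ℝ (X → ℝ)} {S : Set g.Site}
    (hG : LocalMajorant blk Gl S fun y y' => CG * g.len y ^ 2 * Real.exp (-(δ₂ * g.dist y y')))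
    (hGE : ∀ i ∈ D, LocalMajorant blk (Gl * E i) S fun y y' => C₁ * g.len y ^ 2 * Real.exp (-(δ₂ * g.dist y y')))
    (hc : ∀ i ∈ D, ∀ x, |c i x| ≤ s₁ / (g.M * g.len (blk x) ^ 2)) (hcS : ∀ i ∈ D, ∀ x, c i x ≠ 0 → blk x ∈ S)
    (hc₀ : ∀ x, |c₀ x| ≤ s₂ / (g.M * g.len (blk x) ^ 2)) (hc₀S : ∀ x, c₀ x ≠ 0 → blk x ∈ S)
    (hI1 : ∀ x, |hI x| ≤ 1) (hIS : ∀ x, hI x ≠ 0 → blk x ∈ S) :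
    HasMajorant blk (mulOp hI * Gl * (∑ i ∈ D, E i * mulOp (c i) - mulOp c₀)) fun y y' =>
      ind S y * ind S y' * (((D.card : ℝ) * (s₁ * C₁) + s₂ * CG) * g.L ^ 2 / g.M * Real.exp (-(7 / 8 * δ₂ * g.dist y y'))) := by
  classical
  -- distribute `h_□G_□` over the first-order sum
  have e : mulOp hI * Gl * (∑ i ∈ D, E i * mulOp (c i) - mulOp c₀) =
      ∑ i ∈ D, mulOp hI * (Gl * E i) * mulOp (c i) + -(mulOp hI * Gl * mulOp c₀) := by
    rw [mul_sub, Finset.mul_sum, sub_eq_add_neg]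
    simp only [mul_assoc]
  rw [e]
  have h1 : ∀ i ∈ D, HasMajorant blk (mulOp hI * (Gl * E i) * mulOp (c i))
      (fun y y' => ind S y * ind S y' * (s₁ * C₁ * g.L ^ 2 / g.M * Real.exp (-(7 / 8 * δ₂ * g.dist y y')))) := fun i hi =>
    sandwichT_term_hasMajorant blk hL hη hsep hM hδ₂ hC₁ hs₁ hRM hthr (hGE i hi) hI1 hIS (hc i hi) (hcS i hi)
  have h0 := hasMajorant_neg' blk (sandwichT_term_hasMajorant blk hL hη hsep hM hδ₂ hCG hs₂ hRM hthr hG hI1 hIS hc₀ hc₀S)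
  refine hasMajorant_mono blk (hasMajorant_add blk (hasMajorant_finsetSum blk D _ _ h1) h0) fun y y' => ?_
  rw [Finset.sum_const, nsmul_eq_mul]
  have e1 : (D.card : ℝ) * (ind S y * ind S y' * (s₁ * C₁ * g.L ^ 2 / g.M * Real.exp (-(7 / 8 * δ₂ * g.dist y y')))) +
        ind S y * ind S y' * (s₂ * CG * g.L ^ 2 / g.M * Real.exp (-(7 / 8 * δ₂ * g.dist y y'))) =
      ind S y * ind S y' * (((D.card : ℝ) * (s₁ * C₁) + s₂ * CG) * g.L ^ 2 / g.M * Real.exp (-(7 / 8 * δ₂ * g.dist y y'))) := by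
    ring
  exact e1.le

end LineOne

/-! ## §4  Lines 2 and 4 of (2.92) read from the right: `(h_□G_□)·(h_□N − Nh_□)` -/

section CommLines

/-- **A COMMUTATOR LINE READ FROM THE RIGHT** — `(h_□G_□)·(h_□N − Nh_□)` with `h_□G_□` under the GLOBAL majorant `C_G(L^jη)²e^{−δ₂d}` (outputs in `supp h_□`,
inputs anywhere), the partner `N` In- and Out-localised over `T ⊇ supp h_□` with `C_N(L^jη)^{−2}e^{−δ₂d}` ((2.88)-shape), `h_□` block-Lipschitz
`(s/M)(d + r₀)`: majorant `(s/M)·C_NC_GL²(8/δ₂ + r₀)c²·e^{−½δ₂d}` — the commutator by p38's `hasMajorant_comm_inout`, the scale ratio between the two ends of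
`G_□` by `ratio_exp_le`, the Lipschitz factor by `lip_exp_le`, the `y″`-sum by (2.63) (`sum_le`).
[cite: Balaban1984PropagatorsII, (2.134) p.247 + (2.92) p.239 (lines 2, 4) + p.238 + Lemma 2.1 (2.60), (2.63) p.234] -/
theorem commLineT_hasMajorant (blk : X → g.Site) (hL : 1 ≤ g.L) (hη : 0 < g.eta) (hsep : LevelSep g)
    (hd : ∀ a b, 0 ≤ g.dist a b) {δ₂ CN CG c s r₀ : ℝ} (hδ₂ : 0 < δ₂) (hCN : 0 ≤ CN) (hCG : 0 ≤ CG)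
    (hs : 0 ≤ s) (hr₀ : 0 ≤ r₀) (hM : 0 < g.M) (hRM : 0 ≤ g.R * g.M)
    (hthr : g.L ^ 2 ≤ Real.exp (1 / 8 * δ₂ * (g.R * g.M))) (h263 : Ineq263With c g (3 / 4 * δ₂) (1 / 3))
    {N HG : Module.End ℝ (X → ℝ)} {hc : X → ℝ} {T : Set g.Site}
    (hNin : InMajorant blk N T fun y y'' => CN / g.len y ^ 2 * Real.exp (-(δ₂ * g.dist y y'')))
    (hNout : ∀ (y'' : g.Site) (μ : X → ℝ) (B : ℝ), BlockSupp blk μ y'' B → ∀ x, blk x ∈ T →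
      |N μ x| ≤ CN / g.len (blk x) ^ 2 * Real.exp (-(δ₂ * g.dist (blk x) y'')) * B)
    (hcT : ∀ x, hc x ≠ 0 → blk x ∈ T) (hLip : ∀ x x', |hc x' - hc x| ≤ s / g.M * (g.dist (blk x) (blk x') + r₀))
    (hHG : HasMajorant blk HG fun y y'' => CG * g.len y ^ 2 * Real.exp (-(δ₂ * g.dist y y''))) :
    HasMajorant blk (HG * (mulOp hc * N - N * mulOp hc)) fun y y' =>
      s / g.M * (CN * CG * g.L ^ 2 * (8 / δ₂ + r₀)) * c ^ 2 * Real.exp (-(1 / 2 * δ₂ * g.dist y y')) := by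
  classical
  have hL0 : 0 < g.L := zero_lt_one.trans_le hL
  have hlen : ∀ z : g.Site, 0 < g.len z := fun z => mul_pos (pow_pos hL0 _) hη
  -- (1) the commutator `Nh − hN` with the block-Lipschitz `h_□`, then its negative
  have hKN : ∀ y y'' : g.Site, 0 ≤ CN / g.len y ^ 2 * Real.exp (-(δ₂ * g.dist y y'')) := fun y y'' => by
    have := hlen y; positivity
  have hlipnn : ∀ y y'' : g.Site, 0 ≤ s / g.M * (g.dist y y'' + r₀) := fun y y'' => by
    have := hd y y''; positivity
  have hcomm := hasMajorant_comm_inout blk hKN hNin hNout hcT hlipnn hLip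
  have hneg : HasMajorant blk (mulOp hc * N - N * mulOp hc) (fun y y' => s / g.M * (g.dist y y' + r₀) * (CN / g.len y ^ 2 * Real.exp (-(δ₂ * g.dist y y')))) := by
    have e : mulOp hc * N - N * mulOp hc = -(N * mulOp hc - mulOp hc * N) := by rw [neg_sub]
    rw [e]
    exact hasMajorant_neg' blk hcomm
  -- (2) composition `(h_□G_□)·(h_□N − Nh_□)`
  have hK₂ : ∀ a b : g.Site, 0 ≤ s / g.M * (g.dist a b + r₀) * (CN / g.len a ^ 2 * Real.exp (-(δ₂ * g.dist a b))) :=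
    fun a b => mul_nonneg (hlipnn a b) (hKN a b)
  refine hasMajorant_mono blk (hasMajorant_mul blk hHG hneg hK₂) fun y y' => ?_
  -- (3) the pointwise bound of one `y″`-term
  have hterm : ∀ y'' : g.Site,
      CG * g.len y ^ 2 * Real.exp (-(δ₂ * g.dist y y'')) *
          (s / g.M * (g.dist y'' y' + r₀) * (CN / g.len y'' ^ 2 * Real.exp (-(δ₂ * g.dist y'' y')))) ≤
        s / g.M * (CN * CG * g.L ^ 2 * (8 / δ₂ + r₀)) *
          (Real.exp (-(3 / 4 * δ₂ * g.dist y y'')) * Real.exp (-(3 / 4 * δ₂ * g.dist y'' y'))) := by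
    intro y''
    have hr := ratio_exp_le hL hη hsep hδ₂.le hRM hthr y y''
    have hlp := lip_exp_le hδ₂ (hd y'' y') hr₀
    have hl := hlen y''
    -- rewrite the term as (ratio·e^{−δ₂d(y,y″)}) · ((d+r₀)e^{−⅛δ₂d(y″,y′)}) · e^{−⅞δ₂d(y″,y′)} · constants
    have hsplit : Real.exp (-(δ₂ * g.dist y'' y')) = Real.exp (-(1 / 8 * δ₂ * g.dist y'' y')) * Real.exp (-(7 / 8 * δ₂ * g.dist y'' y')) := by
      rw [← Real.exp_add]; congr 1; ring
    have e1 : CG * g.len y ^ 2 * Real.exp (-(δ₂ * g.dist y y'')) *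
          (s / g.M * (g.dist y'' y' + r₀) * (CN / g.len y'' ^ 2 * Real.exp (-(δ₂ * g.dist y'' y')))) =
        s / g.M * (CN * CG) * (g.len y ^ 2 / g.len y'' ^ 2 * Real.exp (-(δ₂ * g.dist y y''))) *
          ((g.dist y'' y' + r₀) * Real.exp (-(1 / 8 * δ₂ * g.dist y'' y'))) * Real.exp (-(7 / 8 * δ₂ * g.dist y'' y')) := by
      rw [hsplit]; field_simp
    rw [e1]
    have h78a : Real.exp (-(7 / 8 * δ₂ * g.dist y y'')) ≤ Real.exp (-(3 / 4 * δ₂ * g.dist y y'')) := by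
      apply Real.exp_le_exp.mpr; have := hd y y''; nlinarith
    have h78b : Real.exp (-(7 / 8 * δ₂ * g.dist y'' y')) ≤ Real.exp (-(3 / 4 * δ₂ * g.dist y'' y')) := by
      apply Real.exp_le_exp.mpr; have := hd y'' y'; nlinarith
    have hA : g.len y ^ 2 / g.len y'' ^ 2 * Real.exp (-(δ₂ * g.dist y y'')) ≤ g.L ^ 2 * Real.exp (-(3 / 4 * δ₂ * g.dist y y'')) :=
      hr.trans (mul_le_mul_of_nonneg_left h78a (by positivity))
    have hC : 0 ≤ s / g.M * (CN * CG) := by positivity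
    have hlipnn' : 0 ≤ (g.dist y'' y' + r₀) * Real.exp (-(1 / 8 * δ₂ * g.dist y'' y')) :=
      mul_nonneg (add_nonneg (hd y'' y') hr₀) (Real.exp_nonneg _)
    calc s / g.M * (CN * CG) * (g.len y ^ 2 / g.len y'' ^ 2 * Real.exp (-(δ₂ * g.dist y y''))) *
          ((g.dist y'' y' + r₀) * Real.exp (-(1 / 8 * δ₂ * g.dist y'' y'))) * Real.exp (-(7 / 8 * δ₂ * g.dist y'' y'))
        ≤ s / g.M * (CN * CG) * (g.L ^ 2 * Real.exp (-(3 / 4 * δ₂ * g.dist y y''))) * (8 / δ₂ + r₀) *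
          Real.exp (-(3 / 4 * δ₂ * g.dist y'' y')) := by gcongr
      _ = _ := by ring
  have hKnn : 0 ≤ s / g.M * (CN * CG * g.L ^ 2 * (8 / δ₂ + r₀)) := by positivity
  calc ∑ y'' : g.Site, CG * g.len y ^ 2 * Real.exp (-(δ₂ * g.dist y y'')) *
          (s / g.M * (g.dist y'' y' + r₀) * (CN / g.len y'' ^ 2 * Real.exp (-(δ₂ * g.dist y'' y'))))
      ≤ ∑ y'' : g.Site, s / g.M * (CN * CG * g.L ^ 2 * (8 / δ₂ + r₀)) *
          (Real.exp (-(3 / 4 * δ₂ * g.dist y y'')) * Real.exp (-(3 / 4 * δ₂ * g.dist y'' y'))) :=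
        Finset.sum_le_sum fun y'' _ => hterm y''
    _ = s / g.M * (CN * CG * g.L ^ 2 * (8 / δ₂ + r₀)) *
          ∑ y'' : g.Site, Real.exp (-(3 / 4 * δ₂ * g.dist y y'')) * Real.exp (-(3 / 4 * δ₂ * g.dist y'' y')) := by rw [Finset.mul_sum]
    _ ≤ s / g.M * (CN * CG * g.L ^ 2 * (8 / δ₂ + r₀)) * (c ^ 2 * Real.exp (-(1 / 2 * δ₂ * g.dist y y'))) :=
        mul_le_mul_of_nonneg_left (sum_le h263 y y') hKnn
    _ = _ := by ring

/-- the same with a cut-off `|z| ≤ 1` between `G_□` and the commutator (`(h_□G_□)·z·(h_□N − Nh_□)`, the shape delivered by the V1 decomposition of `[M_□, h_□]`).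
[cite: Balaban1984PropagatorsII, (2.134) p.247 + (2.92) p.239] -/
theorem commLineT_hasMajorant_midCut (blk : X → g.Site) (hL : 1 ≤ g.L) (hη : 0 < g.eta) (hsep : LevelSep g)
    (hd : ∀ a b, 0 ≤ g.dist a b) {δ₂ CN CG c s r₀ : ℝ} (hδ₂ : 0 < δ₂) (hCN : 0 ≤ CN) (hCG : 0 ≤ CG)
    (hs : 0 ≤ s) (hr₀ : 0 ≤ r₀) (hM : 0 < g.M) (hRM : 0 ≤ g.R * g.M)
    (hthr : g.L ^ 2 ≤ Real.exp (1 / 8 * δ₂ * (g.R * g.M))) (h263 : Ineq263With c g (3 / 4 * δ₂) (1 / 3))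
    {N HG : Module.End ℝ (X → ℝ)} {z hc : X → ℝ} {T : Set g.Site}
    (hNin : InMajorant blk N T fun y y'' => CN / g.len y ^ 2 * Real.exp (-(δ₂ * g.dist y y'')))
    (hNout : ∀ (y'' : g.Site) (μ : X → ℝ) (B : ℝ), BlockSupp blk μ y'' B → ∀ x, blk x ∈ T →
      |N μ x| ≤ CN / g.len (blk x) ^ 2 * Real.exp (-(δ₂ * g.dist (blk x) y'')) * B)
    (hz : ∀ x, |z x| ≤ 1) (hcT : ∀ x, hc x ≠ 0 → blk x ∈ T) (hLip : ∀ x x', |hc x' - hc x| ≤ s / g.M * (g.dist (blk x) (blk x') + r₀))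
    (hHG : HasMajorant blk HG fun y y'' => CG * g.len y ^ 2 * Real.exp (-(δ₂ * g.dist y y''))) :
    HasMajorant blk (HG * (mulOp z * (mulOp hc * N - N * mulOp hc))) fun y y' =>
      s / g.M * (CN * CG * g.L ^ 2 * (8 / δ₂ + r₀)) * c ^ 2 * Real.exp (-(1 / 2 * δ₂ * g.dist y y')) := by
  rw [← mul_assoc]
  exact commLineT_hasMajorant blk hL hη hsep hd hδ₂ hCN hCG hs hr₀ hM hRM hthr h263 hNin hNout hcT hLip (hasMajorant_mulOp_right blk hHG hz)

/-- the same with a cut-off `|ζ| ≤ 1` on the right (`(h_□G_□)·(h_□P_□ − P_□h_□)·ζ_□`, line 4 of the reversed (2.92)).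
[cite: Balaban1984PropagatorsII, (2.134) p.247 + (2.92) p.239 (line 4)] -/
theorem commLineT_hasMajorant_rightCut (blk : X → g.Site) (hL : 1 ≤ g.L) (hη : 0 < g.eta) (hsep : LevelSep g)
    (hd : ∀ a b, 0 ≤ g.dist a b) {δ₂ CN CG c s r₀ : ℝ} (hδ₂ : 0 < δ₂) (hCN : 0 ≤ CN) (hCG : 0 ≤ CG)
    (hs : 0 ≤ s) (hr₀ : 0 ≤ r₀) (hM : 0 < g.M) (hRM : 0 ≤ g.R * g.M)
    (hthr : g.L ^ 2 ≤ Real.exp (1 / 8 * δ₂ * (g.R * g.M))) (h263 : Ineq263With c g (3 / 4 * δ₂) (1 / 3))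
    {N HG : Module.End ℝ (X → ℝ)} {ζ hc : X → ℝ} {T : Set g.Site}
    (hNin : InMajorant blk N T fun y y'' => CN / g.len y ^ 2 * Real.exp (-(δ₂ * g.dist y y'')))
    (hNout : ∀ (y'' : g.Site) (μ : X → ℝ) (B : ℝ), BlockSupp blk μ y'' B → ∀ x, blk x ∈ T →
      |N μ x| ≤ CN / g.len (blk x) ^ 2 * Real.exp (-(δ₂ * g.dist (blk x) y'')) * B)
    (hζ : ∀ x, |ζ x| ≤ 1) (hcT : ∀ x, hc x ≠ 0 → blk x ∈ T) (hLip : ∀ x x', |hc x' - hc x| ≤ s / g.M * (g.dist (blk x) (blk x') + r₀))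
    (hHG : HasMajorant blk HG fun y y'' => CG * g.len y ^ 2 * Real.exp (-(δ₂ * g.dist y y''))) :
    HasMajorant blk (HG * ((mulOp hc * N - N * mulOp hc) * mulOp ζ)) fun y y' =>
      s / g.M * (CN * CG * g.L ^ 2 * (8 / δ₂ + r₀)) * c ^ 2 * Real.exp (-(1 / 2 * δ₂ * g.dist y y')) := by
  rw [← mul_assoc]
  exact hasMajorant_mulOp_right blk
    (commLineT_hasMajorant blk hL hη hsep hd hδ₂ hCN hCG hs hr₀ hM hRM hthr h263 hNin hNout hcT hLip hHG) hζ

end CommLines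

/-! ## §5  Line 3 of (2.92) read from the right: `(h_□G_□)·D₃ᵀ` -/

section DomLine

/-- **LINE 3 READ FROM THE RIGHT IN (2.134)** — `(h_□G_□)·D₃ᵀ`, `D₃ᵀ = h_□(∂P∂* − ∂P_□∂*)ζ_□` under the majorant `C_De^{−c_DM}(L^{j″}η)^{−2}e^{−δ₂d}` (p22's
`line3_cube_transpose`) and `h_□G_□` under the global `C_G(L^jη)²e^{−δ₂d}`: majorant `C_De^{−c_DM}C_GL²c²·e^{−½δ₂d}`.
[cite: Balaban1984PropagatorsII, (2.134) p.247 + (2.92) p.239 (line 3) + p.238] -/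
theorem domLineT_hasMajorant (blk : X → g.Site) (hL : 1 ≤ g.L) (hη : 0 < g.eta) (hsep : LevelSep g)
    (hd : ∀ a b, 0 ≤ g.dist a b) {δ₂ CD cD CG c : ℝ} (hδ₂ : 0 ≤ δ₂) (hCD : 0 ≤ CD) (hCG : 0 ≤ CG)
    (hRM : 0 ≤ g.R * g.M) (hthr : g.L ^ 2 ≤ Real.exp (1 / 8 * δ₂ * (g.R * g.M)))
    (h263 : Ineq263With c g (3 / 4 * δ₂) (1 / 3))
    {D₃ HG : Module.End ℝ (X → ℝ)}
    (hD : HasMajorant blk D₃ fun y'' y' => CD * Real.exp (-(cD * g.M)) / g.len y'' ^ 2 * Real.exp (-(δ₂ * g.dist y'' y')))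
    (hHG : HasMajorant blk HG fun y y'' => CG * g.len y ^ 2 * Real.exp (-(δ₂ * g.dist y y''))) :
    HasMajorant blk (HG * D₃) fun y y' =>
      CD * Real.exp (-(cD * g.M)) * CG * g.L ^ 2 * c ^ 2 * Real.exp (-(1 / 2 * δ₂ * g.dist y y')) := by
  classical
  have hL0 : 0 < g.L := zero_lt_one.trans_le hL
  have hlen : ∀ z : g.Site, 0 < g.len z := fun z => mul_pos (pow_pos hL0 _) hη
  have hCP : 0 ≤ CD * Real.exp (-(cD * g.M)) := mul_nonneg hCD (Real.exp_nonneg _)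
  have hK₂ : ∀ a b : g.Site, 0 ≤ CD * Real.exp (-(cD * g.M)) / g.len a ^ 2 * Real.exp (-(δ₂ * g.dist a b)) := fun a b => by
    have := hlen a; positivity
  refine hasMajorant_mono blk (hasMajorant_mul blk hHG hD hK₂) fun y y' => ?_
  have hterm : ∀ y'' : g.Site,
      CG * g.len y ^ 2 * Real.exp (-(δ₂ * g.dist y y'')) * (CD * Real.exp (-(cD * g.M)) / g.len y'' ^ 2 * Real.exp (-(δ₂ * g.dist y'' y'))) ≤
        CD * Real.exp (-(cD * g.M)) * CG * g.L ^ 2 * (Real.exp (-(3 / 4 * δ₂ * g.dist y y'')) * Real.exp (-(3 / 4 * δ₂ * g.dist y'' y'))) := by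
    intro y''
    have hr := ratio_exp_le hL hη hsep hδ₂ hRM hthr y y''
    have hl := hlen y''
    have e1 : CG * g.len y ^ 2 * Real.exp (-(δ₂ * g.dist y y'')) * (CD * Real.exp (-(cD * g.M)) / g.len y'' ^ 2 * Real.exp (-(δ₂ * g.dist y'' y'))) =
        CD * Real.exp (-(cD * g.M)) * CG * (g.len y ^ 2 / g.len y'' ^ 2 * Real.exp (-(δ₂ * g.dist y y''))) * Real.exp (-(δ₂ * g.dist y'' y')) := by
      field_simp
    rw [e1]
    have h78a : Real.exp (-(7 / 8 * δ₂ * g.dist y y'')) ≤ Real.exp (-(3 / 4 * δ₂ * g.dist y y'')) := by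
      apply Real.exp_le_exp.mpr; have := hd y y''; nlinarith
    have hb : Real.exp (-(δ₂ * g.dist y'' y')) ≤ Real.exp (-(3 / 4 * δ₂ * g.dist y'' y')) := by
      apply Real.exp_le_exp.mpr; have := hd y'' y'; nlinarith
    have hA : g.len y ^ 2 / g.len y'' ^ 2 * Real.exp (-(δ₂ * g.dist y y'')) ≤ g.L ^ 2 * Real.exp (-(3 / 4 * δ₂ * g.dist y y'')) :=
      hr.trans (mul_le_mul_of_nonneg_left h78a (by positivity))
    have hC : 0 ≤ CD * Real.exp (-(cD * g.M)) * CG := mul_nonneg hCP hCG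
    calc CD * Real.exp (-(cD * g.M)) * CG * (g.len y ^ 2 / g.len y'' ^ 2 * Real.exp (-(δ₂ * g.dist y y''))) * Real.exp (-(δ₂ * g.dist y'' y'))
        ≤ CD * Real.exp (-(cD * g.M)) * CG * (g.L ^ 2 * Real.exp (-(3 / 4 * δ₂ * g.dist y y''))) * Real.exp (-(3 / 4 * δ₂ * g.dist y'' y')) := by
          gcongr
      _ = _ := by ring
  have hKnn : 0 ≤ CD * Real.exp (-(cD * g.M)) * CG * g.L ^ 2 := by positivity
  calc ∑ y'' : g.Site, CG * g.len y ^ 2 * Real.exp (-(δ₂ * g.dist y y'')) *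
          (CD * Real.exp (-(cD * g.M)) / g.len y'' ^ 2 * Real.exp (-(δ₂ * g.dist y'' y')))
      ≤ ∑ y'' : g.Site, CD * Real.exp (-(cD * g.M)) * CG * g.L ^ 2 *
          (Real.exp (-(3 / 4 * δ₂ * g.dist y y'')) * Real.exp (-(3 / 4 * δ₂ * g.dist y'' y'))) :=
        Finset.sum_le_sum fun y'' _ => hterm y''
    _ = CD * Real.exp (-(cD * g.M)) * CG * g.L ^ 2 *
          ∑ y'' : g.Site, Real.exp (-(3 / 4 * δ₂ * g.dist y y'')) * Real.exp (-(3 / 4 * δ₂ * g.dist y'' y')) := by rw [Finset.mul_sum]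
    _ ≤ CD * Real.exp (-(cD * g.M)) * CG * g.L ^ 2 * (c ^ 2 * Real.exp (-(1 / 2 * δ₂ * g.dist y y'))) :=
        mul_le_mul_of_nonneg_left (sum_le h263 y y') hKnn
    _ = _ := by ring

end DomLine

/-! ## §6  (2.93) read from the right: `(h_{□′}G_{□′})·(h_{□′}∂P∂*(1 − ζ_{□′}))·h_□²` -/

section OffDiag

/-- **THE GAP FACTOR READ FROM THE OUTPUT SIDE**: `h_{□′}·∂P∂*·w` with `∂P∂*` under `C_P(L^{j″}η)^{−2}e^{−δ₂d}` ((2.88)-shape), `h_{□′}` supported over `S`,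
`w = 1 − ζ_{□′}` vanishing on the blocks of the core `Score`, and the gap `mM ≤ d(y″,b)` for `y″ ∈ S`, `b ∉ Score` (*"distance ⅓M"*): majorant
`C_P(L^{j″}η)^{−2}e^{−⅛δ₂mM}·e^{−⅞δ₂d(y″,b)}`. [cite: Balaban1984PropagatorsII, (2.134) p.247 + (2.93) p.239 + p.238] -/
theorem gapT_hasMajorant (blk : X → g.Site) (hL : 0 < g.L) (hη : 0 < g.eta)
    {δ₂ CP m : ℝ} (hδ₂ : 0 ≤ δ₂) (hCP : 0 ≤ CP)
    {DP : Module.End ℝ (X → ℝ)} {hI w : X → ℝ} {S Score : Set g.Site}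
    (hP : HasMajorant blk DP fun y'' b => CP / g.len y'' ^ 2 * Real.exp (-(δ₂ * g.dist y'' b)))
    (hI1 : ∀ x, |hI x| ≤ 1) (hIS : ∀ x, hI x ≠ 0 → blk x ∈ S)
    (hw1 : ∀ x, |w x| ≤ 1) (hwS : ∀ x, w x ≠ 0 → blk x ∉ Score)
    (hgap : ∀ y'' b, y'' ∈ S → b ∉ Score → m * g.M ≤ g.dist y'' b) :
    HasMajorant blk (mulOp hI * DP * mulOp w) fun y'' b =>
      CP / g.len y'' ^ 2 * Real.exp (-(1 / 8 * δ₂ * (m * g.M))) * Real.exp (-(7 / 8 * δ₂ * g.dist y'' b)) := by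
  classical
  have hlen : ∀ z : g.Site, 0 < g.len z := fun z => mul_pos (pow_pos hL _) hη
  intro b μ B hμ x
  beta_reduce
  have hnn : 0 ≤ CP / g.len (blk x) ^ 2 * Real.exp (-(1 / 8 * δ₂ * (m * g.M))) * Real.exp (-(7 / 8 * δ₂ * g.dist (blk x) b)) * B := by
    have := hlen (blk x); have := hμ.nonneg; positivity
  rw [Module.End.mul_apply, Module.End.mul_apply, mulOp_apply]
  by_cases hx : hI x = 0
  · rw [hx, zero_mul, abs_zero]; exact hnn
  have hxS : blk x ∈ S := hIS x hx
  by_cases hb : b ∈ Score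
  · have hwS' : ∀ x, w x ≠ 0 → blk x ∈ Scoreᶜ := fun x hx => hwS x hx
    have hb' : b ∉ Scoreᶜ := fun h => h hb
    rw [mulOp_eq_zero_of_blockSupp blk hwS' hμ hb', map_zero, Pi.zero_apply, mul_zero, abs_zero]
    exact hnn
  have hgb := hgap (blk x) b hxS hb
  have h1 := hP b (mulOp w μ) B (blockSupp_mulOp blk hw1 hμ) x
  have hsplit : Real.exp (-(δ₂ * g.dist (blk x) b)) =
      Real.exp (-(1 / 8 * δ₂ * g.dist (blk x) b)) * Real.exp (-(7 / 8 * δ₂ * g.dist (blk x) b)) := by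
    rw [← Real.exp_add]; congr 1; ring
  have hgapE : Real.exp (-(1 / 8 * δ₂ * g.dist (blk x) b)) ≤ Real.exp (-(1 / 8 * δ₂ * (m * g.M))) := by
    apply Real.exp_le_exp.mpr
    have : 1 / 8 * δ₂ * (m * g.M) ≤ 1 / 8 * δ₂ * g.dist (blk x) b := mul_le_mul_of_nonneg_left hgb (by positivity)
    linarith
  rw [abs_mul]
  have hl := hlen (blk x)
  calc |hI x| * |DP (mulOp w μ) x| ≤ 1 * (CP / g.len (blk x) ^ 2 * Real.exp (-(δ₂ * g.dist (blk x) b)) * B) :=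
        mul_le_mul (hI1 x) h1 (abs_nonneg _) zero_le_one
    _ = CP / g.len (blk x) ^ 2 * Real.exp (-(1 / 8 * δ₂ * g.dist (blk x) b)) * Real.exp (-(7 / 8 * δ₂ * g.dist (blk x) b)) * B := by
        rw [one_mul, hsplit]; ring
    _ ≤ CP / g.len (blk x) ^ 2 * Real.exp (-(1 / 8 * δ₂ * (m * g.M))) * Real.exp (-(7 / 8 * δ₂ * g.dist (blk x) b)) * B := by
        have hμ0 := hμ.nonneg
        gcongr

/-- **(2.134), OFF-DIAGONAL PAIRS, READ FROM THE RIGHT** — `(h_{□′}G_{□′})·(h_{□′}∂P∂*(1 − ζ_{□′}))·a` (`a = h_□²`): with `h_{□′}G_{□′}` under the global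
`C_G(L^jη)²e^{−δ₂d}`, `∂P∂*` under `C_P(L^jη)^{−2}e^{−δ₂d}`, `|a| ≤ 1`, and the gap `mM` between `supp h_{□′}` and `{ζ_{□′} ≠ 1}`: majorant
`C_PC_GL²c²e^{−⅛δ₂mM}·e^{−½δ₂d}` (the mirror of r03's `offDiag_hasMajorant`; `= O(M⁻¹)` by r03's `theta_le`).
[cite: Balaban1984PropagatorsII, (2.134) p.247 + (2.93) p.239 + Lemma 2.1 (2.60), (2.63) p.234] -/
theorem offDiagT_hasMajorant (blk : X → g.Site) (hL : 1 ≤ g.L) (hη : 0 < g.eta) (hsep : LevelSep g)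
    (hd : ∀ a b, 0 ≤ g.dist a b) {δ₂ CP CG c m : ℝ} (hδ₂ : 0 ≤ δ₂) (hCP : 0 ≤ CP) (hCG : 0 ≤ CG)
    (hRM : 0 ≤ g.R * g.M) (hthr : g.L ^ 2 ≤ Real.exp (1 / 8 * δ₂ * (g.R * g.M)))
    (h263 : Ineq263With c g (3 / 4 * δ₂) (1 / 3))
    {DP HG : Module.End ℝ (X → ℝ)} {hI w a : X → ℝ} {S Score : Set g.Site}
    (hP : HasMajorant blk DP fun y'' b => CP / g.len y'' ^ 2 * Real.exp (-(δ₂ * g.dist y'' b)))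
    (hHG : HasMajorant blk HG fun y y'' => CG * g.len y ^ 2 * Real.exp (-(δ₂ * g.dist y y'')))
    (hI1 : ∀ x, |hI x| ≤ 1) (hIS : ∀ x, hI x ≠ 0 → blk x ∈ S)
    (hw1 : ∀ x, |w x| ≤ 1) (hwS : ∀ x, w x ≠ 0 → blk x ∉ Score) (ha1 : ∀ x, |a x| ≤ 1)
    (hgap : ∀ y'' b, y'' ∈ S → b ∉ Score → m * g.M ≤ g.dist y'' b) :
    HasMajorant blk (HG * (mulOp hI * DP * mulOp w) * mulOp a) fun y y' =>
      CP * CG * g.L ^ 2 * c ^ 2 * Real.exp (-(1 / 8 * δ₂ * (m * g.M))) * Real.exp (-(1 / 2 * δ₂ * g.dist y y')) := by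
  classical
  have hL0 : 0 < g.L := zero_lt_one.trans_le hL
  have hlen : ∀ z : g.Site, 0 < g.len z := fun z => mul_pos (pow_pos hL0 _) hη
  have hMid := hasMajorant_mulOp_right blk (gapT_hasMajorant blk hL0 hη hδ₂ hCP hP hI1 hIS hw1 hwS hgap) ha1
  have hK₂ : ∀ y'' b : g.Site, 0 ≤ CP / g.len y'' ^ 2 * Real.exp (-(1 / 8 * δ₂ * (m * g.M))) * Real.exp (-(7 / 8 * δ₂ * g.dist y'' b)) :=
    fun y'' b => by have := hlen y''; positivity
  rw [mul_assoc]
  refine hasMajorant_mono blk (hasMajorant_mul blk hHG hMid hK₂) fun y y' => ?_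
  have hterm : ∀ y'' : g.Site,
      CG * g.len y ^ 2 * Real.exp (-(δ₂ * g.dist y y'')) *
          (CP / g.len y'' ^ 2 * Real.exp (-(1 / 8 * δ₂ * (m * g.M))) * Real.exp (-(7 / 8 * δ₂ * g.dist y'' y'))) ≤
        CP * CG * g.L ^ 2 * Real.exp (-(1 / 8 * δ₂ * (m * g.M))) *
          (Real.exp (-(3 / 4 * δ₂ * g.dist y y'')) * Real.exp (-(3 / 4 * δ₂ * g.dist y'' y'))) := by
    intro y''
    have hr := ratio_exp_le hL hη hsep hδ₂ hRM hthr y y''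
    have hl := hlen y''
    have e1 : CG * g.len y ^ 2 * Real.exp (-(δ₂ * g.dist y y'')) *
          (CP / g.len y'' ^ 2 * Real.exp (-(1 / 8 * δ₂ * (m * g.M))) * Real.exp (-(7 / 8 * δ₂ * g.dist y'' y'))) =
        CP * CG * Real.exp (-(1 / 8 * δ₂ * (m * g.M))) * (g.len y ^ 2 / g.len y'' ^ 2 * Real.exp (-(δ₂ * g.dist y y''))) *
          Real.exp (-(7 / 8 * δ₂ * g.dist y'' y')) := by
      field_simp
    rw [e1]
    have h78a : Real.exp (-(7 / 8 * δ₂ * g.dist y y'')) ≤ Real.exp (-(3 / 4 * δ₂ * g.dist y y'')) := by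
      apply Real.exp_le_exp.mpr; have := hd y y''; nlinarith
    have h78b : Real.exp (-(7 / 8 * δ₂ * g.dist y'' y')) ≤ Real.exp (-(3 / 4 * δ₂ * g.dist y'' y')) := by
      apply Real.exp_le_exp.mpr; have := hd y'' y'; nlinarith
    have hA : g.len y ^ 2 / g.len y'' ^ 2 * Real.exp (-(δ₂ * g.dist y y'')) ≤ g.L ^ 2 * Real.exp (-(3 / 4 * δ₂ * g.dist y y'')) :=
      hr.trans (mul_le_mul_of_nonneg_left h78a (by positivity))
    have hC : 0 ≤ CP * CG * Real.exp (-(1 / 8 * δ₂ * (m * g.M))) := by positivity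
    calc CP * CG * Real.exp (-(1 / 8 * δ₂ * (m * g.M))) * (g.len y ^ 2 / g.len y'' ^ 2 * Real.exp (-(δ₂ * g.dist y y''))) *
          Real.exp (-(7 / 8 * δ₂ * g.dist y'' y'))
        ≤ CP * CG * Real.exp (-(1 / 8 * δ₂ * (m * g.M))) * (g.L ^ 2 * Real.exp (-(3 / 4 * δ₂ * g.dist y y''))) *
          Real.exp (-(3 / 4 * δ₂ * g.dist y'' y')) := by gcongr
      _ = _ := by ring
  have hKnn : 0 ≤ CP * CG * g.L ^ 2 * Real.exp (-(1 / 8 * δ₂ * (m * g.M))) := by positivity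
  calc ∑ y'' : g.Site, CG * g.len y ^ 2 * Real.exp (-(δ₂ * g.dist y y'')) *
          (CP / g.len y'' ^ 2 * Real.exp (-(1 / 8 * δ₂ * (m * g.M))) * Real.exp (-(7 / 8 * δ₂ * g.dist y'' y')))
      ≤ ∑ y'' : g.Site, CP * CG * g.L ^ 2 * Real.exp (-(1 / 8 * δ₂ * (m * g.M))) *
          (Real.exp (-(3 / 4 * δ₂ * g.dist y y'')) * Real.exp (-(3 / 4 * δ₂ * g.dist y'' y'))) :=
        Finset.sum_le_sum fun y'' _ => hterm y''
    _ = CP * CG * g.L ^ 2 * Real.exp (-(1 / 8 * δ₂ * (m * g.M))) *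
          ∑ y'' : g.Site, Real.exp (-(3 / 4 * δ₂ * g.dist y y'')) * Real.exp (-(3 / 4 * δ₂ * g.dist y'' y')) := by rw [Finset.mul_sum]
    _ ≤ CP * CG * g.L ^ 2 * Real.exp (-(1 / 8 * δ₂ * (m * g.M))) * (c ^ 2 * Real.exp (-(1 / 2 * δ₂ * g.dist y y'))) :=
        mul_le_mul_of_nonneg_left (sum_le h263 y y') hKnn
    _ = _ := by ring

/-- **(2.134) OFF-DIAGONAL FROM THE RIGHT, WITH THE LOCALISATION INDICATORS** of the two cubes (`supp h_{□′} ⊂ U_{□′}` at the output, `supp h_□² ⊂ U_□` at the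
input) — the shape consumed by the mirror gluing `…B6Prop26RightChainGeneric.prop26_rightEntry_of_2133T_2134T`.
[cite: Balaban1984PropagatorsII, (2.134)–(2.135) p.247 + (2.93) p.239] -/
theorem offDiagT_hasMajorant_ind (blk : X → g.Site) (hL : 1 ≤ g.L) (hη : 0 < g.eta) (hsep : LevelSep g)
    (hd : ∀ a b, 0 ≤ g.dist a b) {δ₂ CP CG c m : ℝ} (hδ₂ : 0 ≤ δ₂) (hCP : 0 ≤ CP) (hCG : 0 ≤ CG)
    (hRM : 0 ≤ g.R * g.M) (hthr : g.L ^ 2 ≤ Real.exp (1 / 8 * δ₂ * (g.R * g.M)))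
    (h263 : Ineq263With c g (3 / 4 * δ₂) (1 / 3))
    {DP GJ : Module.End ℝ (X → ℝ)} {hJ w a : X → ℝ} {S Score UJ UI : Set g.Site}
    (hP : HasMajorant blk DP fun y'' b => CP / g.len y'' ^ 2 * Real.exp (-(δ₂ * g.dist y'' b)))
    (hHG : HasMajorant blk (mulOp hJ * GJ) fun y y'' => CG * g.len y ^ 2 * Real.exp (-(δ₂ * g.dist y y'')))
    (hJ1 : ∀ x, |hJ x| ≤ 1) (hJS : ∀ x, hJ x ≠ 0 → blk x ∈ S) (hSU : S ⊆ UJ)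
    (hw1 : ∀ x, |w x| ≤ 1) (hwS : ∀ x, w x ≠ 0 → blk x ∉ Score) (ha1 : ∀ x, |a x| ≤ 1) (haU : ∀ x, a x ≠ 0 → blk x ∈ UI)
    (hgap : ∀ y'' b, y'' ∈ S → b ∉ Score → m * g.M ≤ g.dist y'' b) :
    HasMajorant blk (mulOp hJ * GJ * (mulOp hJ * DP * mulOp w) * mulOp a) fun y y' =>
      ind UJ y * ind UI y' * (CP * CG * g.L ^ 2 * c ^ 2 * Real.exp (-(1 / 8 * δ₂ * (m * g.M))) * Real.exp (-(1 / 2 * δ₂ * g.dist y y'))) := by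
  have h0 := offDiagT_hasMajorant blk hL hη hsep hd hδ₂ hCP hCG hRM hthr h263 hP hHG hJ1 hJS hw1 hwS ha1 hgap
  have hK : ∀ y y' : g.Site, 0 ≤ CP * CG * g.L ^ 2 * c ^ 2 * Real.exp (-(1 / 8 * δ₂ * (m * g.M))) * Real.exp (-(1 / 2 * δ₂ * g.dist y y')) :=
    fun y y' => by positivity
  have e : mulOp hJ * GJ * (mulOp hJ * DP * mulOp w) * mulOp a = mulOp hJ * (GJ * (mulOp hJ * DP * mulOp w) * mulOp a) := by
    simp only [mul_assoc]
  rw [e] at h0 ⊢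
  have hin : InLoc blk (mulOp hJ * (GJ * (mulOp hJ * DP * mulOp w) * mulOp a)) UI := by
    have h1 := inLoc_mul_mulOp blk (mulOp hJ * (GJ * (mulOp hJ * DP * mulOp w))) haU
    have e' : mulOp hJ * (GJ * (mulOp hJ * DP * mulOp w)) * mulOp a = mulOp hJ * (GJ * (mulOp hJ * DP * mulOp w) * mulOp a) := by
      simp only [mul_assoc]
    rw [e'] at h1
    exact h1
  have h1 := hasMajorant_indIn_of_inLoc blk hK h0 hin
  have h2 := hasMajorant_indOut blk (fun y y' => mul_nonneg (ind_nonneg _ _) (hK y y')) h1 fun x hx => hSU (hJS x hx)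
  refine hasMajorant_mono blk h2 fun y y' => ?_
  exact (by ring : ind UJ y * (ind UI y' * (CP * CG * g.L ^ 2 * c ^ 2 * Real.exp (-(1 / 8 * δ₂ * (m * g.M))) *
    Real.exp (-(1 / 2 * δ₂ * g.dist y y')))) = _).le

end OffDiag

/-! ## §7  The whole reversed diagonal kernel `h_□G_□K̃_{□,□}` -/

section Diagonal

/-- input localisation is additive. [cite: Balaban1984PropagatorsII, (2.91) p.239, bookkeeping] -/
private theorem inLoc_add (blk : X → g.Site) {T T' : Module.End ℝ (X → ℝ)} {U : Set g.Site} (hT : InLoc blk T U) (hT' : InLoc blk T' U) :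
    InLoc blk (T + T') U := by
  intro y' μ B hμ hy'
  rw [LinearMap.add_apply, hT y' μ B hμ hy', hT' y' μ B hμ hy', add_zero]

/-- input localisation is subtractive. [cite: Balaban1984PropagatorsII, (2.91) p.239, bookkeeping] -/
private theorem inLoc_sub (blk : X → g.Site) {T T' : Module.End ℝ (X → ℝ)} {U : Set g.Site} (hT : InLoc blk T U) (hT' : InLoc blk T' U) :
    InLoc blk (T - T') U := by
  intro y' μ B hμ hy'
  rw [LinearMap.sub_apply, hT y' μ B hμ hy', hT' y' μ B hμ hy', sub_zero]

/-- input localisation of finite sums. [cite: Balaban1984PropagatorsII, (2.91) p.239, bookkeeping] -/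
private theorem inLoc_finsetSum (blk : X → g.Site) {ι : Type} (D : Finset ι) {T : ι → Module.End ℝ (X → ℝ)} {U : Set g.Site}
    (hT : ∀ i ∈ D, InLoc blk (T i) U) : InLoc blk (∑ i ∈ D, T i) U := by
  classical
  induction D using Finset.induction_on with
  | empty => intro y' μ B hμ hy'; simp
  | insert a s ha ih =>
      rw [Finset.sum_insert ha]
      exact inLoc_add blk (hT a (Finset.mem_insert_self a s)) (ih fun i hi => hT i (Finset.mem_insert_of_mem hi))

/-- **INPUT LOCALISATION OF THE REVERSED DIAGONAL TERM IN ITS COMPACT FORM** `h_□G_□·((M_□h_□ − h_□M_□) + h_□(∂P∂* − P_□)ζ_□ + (h_□P_□ − P_□h_□)ζ_□)`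
over `U` (= `□̃`): `supp h_□ ⊂ S ⊆ U`, the inputs of `h_□M_□` lie over `U` (bond range of `M_□` from `supp h_□` — the mirror of p38's `hMout`, obtained from it
by transposition downstream), and `supp ζ_□ ⊂ U`. [cite: Balaban1984PropagatorsII, (2.91)–(2.92) p.239 (supp h_□, supp ζ_□ ⊂ □̃, range of Δ)] -/
theorem compactT_inLoc (blk : X → g.Site) {Gl Ml Dg Pl : Module.End ℝ (X → ℝ)} {hI ζ : X → ℝ} {S U : Set g.Site} (hSU : S ⊆ U)
    (hIS : ∀ x, hI x ≠ 0 → blk x ∈ S) (hMin : InLoc blk (mulOp hI * Ml) U) (hζU : ∀ x, ζ x ≠ 0 → blk x ∈ U) :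
    InLoc blk (mulOp hI * Gl * ((Ml * mulOp hI - mulOp hI * Ml) + mulOp hI * (Dg - Pl) * mulOp ζ + (mulOp hI * Pl - Pl * mulOp hI) * mulOp ζ)) U := by
  have hIU : ∀ x, hI x ≠ 0 → blk x ∈ U := fun x hx => hSU (hIS x hx)
  exact inLoc_mul blk _ (inLoc_add blk (inLoc_add blk (inLoc_sub blk (inLoc_mul_mulOp blk _ hIU) hMin) (inLoc_mul_mulOp blk _ hζU))
    (inLoc_mul_mulOp blk _ hζU))

/-- **(2.134), DIAGONAL PAIRS □ = □′, READ FROM THE RIGHT** — the whole reversed diagonal term `h_□G_□K̃_{□,□}` in the decomposed form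
`h_□G_□·((((Σ_iE_ic_i − c₀) + Σ_k(h_□N_k − N_kh_□)z_k) + D₃ᵀ) + (h_□P_□ − P_□h_□)ζ_□)` has the majorant `θ_diagᵀ·e^{−½δ₂d}`,
`θ_diagᵀ = (#D·s₁C₁ + s₂C_G)L²/M + (#K + 1)·(s/M)·C_NC_HL²(8/δ₂ + r₀)c² + C_De^{−c_DM}C_HL²c²` (`C_G`: the local majorant of `G_□` over the reach, `C_H`: the global
majorant of `h_□G_□`). [cite: Balaban1984PropagatorsII, (2.134) p.247 + (2.92) p.239 + (2.133) p.247] -/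
theorem diagT_hasMajorant (blk : X → g.Site) (hL : 1 ≤ g.L) (hη : 0 < g.eta) (hsep : LevelSep g)
    (hd : ∀ a b, 0 ≤ g.dist a b) {δ₂ CG CH C₁ CN CD cD c s s₁ s₂ r₀ : ℝ} (hδ₂ : 0 < δ₂) (hCG : 0 ≤ CG) (hCH : 0 ≤ CH)
    (hC₁ : 0 ≤ C₁) (hCN : 0 ≤ CN) (hCD : 0 ≤ CD) (hs : 0 ≤ s) (hs₁ : 0 ≤ s₁) (hs₂ : 0 ≤ s₂) (hr₀ : 0 ≤ r₀)
    (hM : 0 < g.M) (hRM : 0 ≤ g.R * g.M) (hthr : g.L ^ 2 ≤ Real.exp (1 / 8 * δ₂ * (g.R * g.M)))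
    (h263 : Ineq263With c g (3 / 4 * δ₂) (1 / 3))
    {Gl Pl D₃ : Module.End ℝ (X → ℝ)} {hI c₀ ζ : X → ℝ} {S T : Set g.Site}
    {ι : Type} (D : Finset ι) {E : ι → Module.End ℝ (X → ℝ)} {cf : ι → X → ℝ}
    {κ : Type} (DK : Finset κ) {N : κ → Module.End ℝ (X → ℝ)} {z : κ → X → ℝ}
    (hG : LocalMajorant blk Gl S fun y y' => CG * g.len y ^ 2 * Real.exp (-(δ₂ * g.dist y y')))
    (hGE : ∀ i ∈ D, LocalMajorant blk (Gl * E i) S fun y y' => C₁ * g.len y ^ 2 * Real.exp (-(δ₂ * g.dist y y')))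
    (hHG : HasMajorant blk (mulOp hI * Gl) fun y y'' => CH * g.len y ^ 2 * Real.exp (-(δ₂ * g.dist y y'')))
    (hc : ∀ i ∈ D, ∀ x, |cf i x| ≤ s₁ / (g.M * g.len (blk x) ^ 2)) (hcS : ∀ i ∈ D, ∀ x, cf i x ≠ 0 → blk x ∈ S)
    (hc₀ : ∀ x, |c₀ x| ≤ s₂ / (g.M * g.len (blk x) ^ 2)) (hc₀S : ∀ x, c₀ x ≠ 0 → blk x ∈ S)
    (hI1 : ∀ x, |hI x| ≤ 1) (hIS : ∀ x, hI x ≠ 0 → blk x ∈ S) (hST : S ⊆ T)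
    (hLip : ∀ x x', |hI x' - hI x| ≤ s / g.M * (g.dist (blk x) (blk x') + r₀))
    (hNin : ∀ k ∈ DK, InMajorant blk (N k) T fun y y'' => CN / g.len y ^ 2 * Real.exp (-(δ₂ * g.dist y y'')))
    (hNout : ∀ k ∈ DK, ∀ (y'' : g.Site) (μ : X → ℝ) (B : ℝ), BlockSupp blk μ y'' B → ∀ x, blk x ∈ T →
      |N k μ x| ≤ CN / g.len (blk x) ^ 2 * Real.exp (-(δ₂ * g.dist (blk x) y'')) * B)
    (hz : ∀ k ∈ DK, ∀ x, |z k x| ≤ 1)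
    (hPlin : InMajorant blk Pl T fun y y'' => CN / g.len y ^ 2 * Real.exp (-(δ₂ * g.dist y y'')))
    (hPlout : ∀ (y'' : g.Site) (μ : X → ℝ) (B : ℝ), BlockSupp blk μ y'' B → ∀ x, blk x ∈ T →
      |Pl μ x| ≤ CN / g.len (blk x) ^ 2 * Real.exp (-(δ₂ * g.dist (blk x) y'')) * B)
    (hζ : ∀ x, |ζ x| ≤ 1)
    (hD : HasMajorant blk D₃ fun y'' y' => CD * Real.exp (-(cD * g.M)) / g.len y'' ^ 2 * Real.exp (-(δ₂ * g.dist y'' y'))) :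
    HasMajorant blk
      (mulOp hI * Gl * ((((∑ i ∈ D, E i * mulOp (cf i) - mulOp c₀) + ∑ k ∈ DK, (mulOp hI * N k - N k * mulOp hI) * mulOp (z k)) + D₃) +
        (mulOp hI * Pl - Pl * mulOp hI) * mulOp ζ))
      fun y y' =>
        (((D.card : ℝ) * (s₁ * C₁) + s₂ * CG) * g.L ^ 2 / g.M + ((DK.card : ℝ) + 1) * (s / g.M * (CN * CH * g.L ^ 2 * (8 / δ₂ + r₀)) * c ^ 2) +
            CD * Real.exp (-(cD * g.M)) * CH * g.L ^ 2 * c ^ 2) *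
          Real.exp (-(1 / 2 * δ₂ * g.dist y y')) := by
  classical
  have hIT : ∀ x, hI x ≠ 0 → blk x ∈ T := fun x hx => hST (hIS x hx)
  -- distribute `h_□G_□`
  have e : mulOp hI * Gl * ((((∑ i ∈ D, E i * mulOp (cf i) - mulOp c₀) + ∑ k ∈ DK, (mulOp hI * N k - N k * mulOp hI) * mulOp (z k)) + D₃) +
        (mulOp hI * Pl - Pl * mulOp hI) * mulOp ζ) =
      ((mulOp hI * Gl * (∑ i ∈ D, E i * mulOp (cf i) - mulOp c₀) +
        ∑ k ∈ DK, mulOp hI * Gl * ((mulOp hI * N k - N k * mulOp hI) * mulOp (z k))) + mulOp hI * Gl * D₃) +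
        mulOp hI * Gl * ((mulOp hI * Pl - Pl * mulOp hI) * mulOp ζ) := by
    rw [mul_add, mul_add, mul_add, Finset.mul_sum]
  rw [e]
  -- line 1
  have h1 := line1T_hasMajorant blk hL hη hsep hM hδ₂.le hCG hC₁ hs₁ hs₂ hRM hthr D hG hGE hc hcS hc₀ hc₀S hI1 hIS
  -- lines 2 (family) and 4
  have h2 := hasMajorant_finsetSum blk DK (fun k => mulOp hI * Gl * ((mulOp hI * N k - N k * mulOp hI) * mulOp (z k)))
    (fun _ y y' => s / g.M * (CN * CH * g.L ^ 2 * (8 / δ₂ + r₀)) * c ^ 2 * Real.exp (-(1 / 2 * δ₂ * g.dist y y')))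
    fun k hk => commLineT_hasMajorant_rightCut blk hL hη hsep hd hδ₂ hCN hCH hs hr₀ hM hRM hthr h263 (hNin k hk) (hNout k hk) (hz k hk) hIT hLip hHG
  have h4 := commLineT_hasMajorant_rightCut blk hL hη hsep hd hδ₂ hCN hCH hs hr₀ hM hRM hthr h263 hPlin hPlout hζ hIT hLip hHG
  -- line 3
  have h3 := domLineT_hasMajorant blk hL hη hsep hd hδ₂.le hCD hCH hRM hthr h263 hD hHG
  refine hasMajorant_mono blk (hasMajorant_add blk (hasMajorant_add blk (hasMajorant_add blk h1 h2) h3) h4) fun y y' => ?_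
  -- pointwise
  have hθ₁ : 0 ≤ ((D.card : ℝ) * (s₁ * C₁) + s₂ * CG) * g.L ^ 2 / g.M := by positivity
  have hrate : Real.exp (-(7 / 8 * δ₂ * g.dist y y')) ≤ Real.exp (-(1 / 2 * δ₂ * g.dist y y')) := by
    apply Real.exp_le_exp.mpr; have := hd y y'; nlinarith
  have hind : ind S y * ind S y' ≤ 1 := by
    calc ind S y * ind S y' ≤ 1 * 1 := mul_le_mul (ind_le_one _ _) (ind_le_one _ _) (ind_nonneg _ _) zero_le_one
      _ = 1 := one_mul _
  have hl1 : ind S y * ind S y' * (((D.card : ℝ) * (s₁ * C₁) + s₂ * CG) * g.L ^ 2 / g.M * Real.exp (-(7 / 8 * δ₂ * g.dist y y'))) ≤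
      ((D.card : ℝ) * (s₁ * C₁) + s₂ * CG) * g.L ^ 2 / g.M * Real.exp (-(1 / 2 * δ₂ * g.dist y y')) := by
    calc ind S y * ind S y' * (((D.card : ℝ) * (s₁ * C₁) + s₂ * CG) * g.L ^ 2 / g.M * Real.exp (-(7 / 8 * δ₂ * g.dist y y')))
        ≤ 1 * (((D.card : ℝ) * (s₁ * C₁) + s₂ * CG) * g.L ^ 2 / g.M * Real.exp (-(1 / 2 * δ₂ * g.dist y y'))) :=
          mul_le_mul hind (mul_le_mul_of_nonneg_left hrate hθ₁) (by positivity) zero_le_one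
      _ = _ := one_mul _
  rw [Finset.sum_const, nsmul_eq_mul]
  have hc2 : 0 ≤ s / g.M * (CN * CH * g.L ^ 2 * (8 / δ₂ + r₀)) * c ^ 2 * Real.exp (-(1 / 2 * δ₂ * g.dist y y')) := by positivity
  nlinarith [hl1, hc2]

end Diagonal

end Literature.MathematicalPhysics.QuantumFieldTheory.Balaban1983to89.B6Ineq2134TransposeDiag
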